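import Summits.BirchSwinnertonDyer.BirchSwinnertonDyer.Theorems.KatoDescentPotSupersingularReducibleRelativeClassNumberDoors
import HarnessLib

/-!
# THE CANONICAL RELATIVE-CLASS-NUMBER DOORS of crux M: (A) at `(W, p)` on a reducible row with the ODD side discharged by ONE integer
# `#ker (N : Cl_{K_i} → Cl_{K_i^{τ₀}})` at the canonical character field `K₁ = K(P)` / `K₂ = K(P′)`, `τ₀ ∈ Γ_K` a displayed element acting
# on the generator by `a₀ ≢ 1 (mod p)` (route-free helper for crux M = stmt-BirchSwinnertonDyer-19196 `ReducibleKatoMember`, K9 / K8-t′;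
# seat `bsd-potss-rkm` g40; companion of `KatoDescentPotSupersingularReducibleRelativeClassNumberDoors`)

WHY.  `…RelativeClassNumberDoors` §2 takes, per side, a subfield `K_i ⊆ K(χ₁,χ₂)`, an automorphism `σ₀ ∈ Gal(K_i/K)` and a lift `τ₀`.
Here the subfield is the CANONICAL one of g39 (`K₁ = F^{res(fixingSubgroup C)} = K(P)`, `K₂ = F^{res(ker χ₂)} = K(P′)`, `F = K(χ₁,χ₂)`)
and `σ₀` is the RESTRICTION of `τ₀` to it (`F/K` is abelian — tree `isAbelianGalois_borelField` — so `K_i/K` is Galois and Mathlib's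
`AlgEquiv.restrictNormal` applies; compatibility is `AlgEquiv.restrictNormal_apply`).  So a per-row record supplies only: `τ₀`, its
eigenvalue `a₀` on the generator (`a₀ ≡ −1` for a complex conjugation on the odd side), and the ONE integer
`p ∤ #ker (N : Cl_{K_i} → Cl_{K_i^{τ₀}})` — for `K_i` imaginary abelian and `τ₀` a complex conjugation, `#ker N = h⁻(K_i) = h(K_i)/h(K_i⁺)`
(tree `IsCMField.card_ker_classGroupNorm_eq_div`), EXACT by the analytic class number formula — the other side keeping g39's eigen-test.

* `fineSelmerDual_moduleFinite_of_reducible_of_relNorm₁_of_eigenTest₂` — side 1 (`χ₁` on `C`, `K(P)`) by the relative-norm integer,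
  side 2 by the eigen-test at `K(P′)`;
* `fineSelmerDual_moduleFinite_of_reducible_of_eigenTest₁_of_relNorm₂` — side 1 by the eigen-test at `K(P)`, side 2 (`χ₂` on `E[p]/C`,
  `K(P′)`) by the relative-norm integer.

HONEST FRAMING.  Theorems only; route-free; closes nothing: crux M stays cite-level over {Fine, H2X⁺, modularity} and, class-wide, the
`μ`-input `H_IC`; no class number is computed in Lean; BSD is proved for no curve.
References: [Lang1990] Ch. 3 §4 Thm. 4.3, 4.4; [Washington1997] Thm. 4.17, §10.2; [CoatesSujatha2005] Thm. 3.4, Cor. 3.6;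
[DeoRaySujatha2023] §3 Thm. 3.8; [Wuthrich2014] L. 14.
-/

-- the summit and its single problem are both named `BirchSwinnertonDyer` (registry layout D-0017)
set_option linter.dupNamespace false
set_option autoImplicit false

noncomputable section

open scoped Classical Pointwise NumberField nonZeroDivisors
open Field NumberField IsDedekindDomain IntermediateField WeierstrassCurve
open Literature.NumberTheory.EllipticCurves Literature.NumberTheory.EllipticCurves.GreenbergSelmer
open Literature.NumberTheory.GaloisRepresentations Literature.NumberTheory.IwasawaTheory Literature.NumberTheory.NumberFields
open Literature.NumberTheory.EllipticCurves.FineSelmerReducibleIsotypic Literature.NumberTheory.EllipticCurves.CoatesSujatha2005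
open Literature.NumberTheory.EllipticCurves.ZpExtension
open Summit.BirchSwinnertonDyer.BirchSwinnertonDyer.Theorems
open Summit.BirchSwinnertonDyer.BirchSwinnertonDyer.Theorems.ReducibleFineSelmerCharacterFields
open Summit.BirchSwinnertonDyer.BirchSwinnertonDyer.Theorems.ReducibleFineSelmerLayerZero
open Summit.BirchSwinnertonDyer.BirchSwinnertonDyer.Theorems.ReducibleFineSelmerRelativeClassNumber

namespace Summit.BirchSwinnertonDyer.BirchSwinnertonDyer.Theorems.ReducibleFineSelmerRelativeClassNumberCanonical

/-! ## The CANONICAL relative-norm doors: `K₁ = F^{res(fixingSubgroup C)} = K(P)`, `K₂ = F^{res(ker χ₂)} = K(P′)`, with `σ₀` the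
RESTRICTION of a displayed `τ₀ ∈ Γ_K` (no subfield, no automorphism to supply: only `τ₀`, its eigenvalue `a₀` on the generator, and
the one integer `#ker N_{K_i/K_i^{τ₀}}`) -/

section Canonical

variable {K : Type} [Field K] [NumberField K] (W : WeierstrassCurve K) [W.IsElliptic] {p : ℕ} [Fact p.Prime]

/-- **(A) on a reducible row: side 1 by the RELATIVE-NORM integer at the canonical `K₁ = K(P)`, side 2 by the eigen-test at the canonical
`K₂ = K(P′)`.**  Data on side 1: `τ₀ ∈ Γ_K` with `τ₀•P = a₀•P`, `a₀ ≢ 1 (mod p)`, and `p ∤ #ker (N : Cl_{K₁} → Cl_{K₁^{τ₀}})`, where `τ₀` acts on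
`K₁` through its restriction `(res_F τ₀)|_{K₁}` (`F = K(χ₁,χ₂)` is abelian over `K`, so `K₁/K` is Galois); for `K₁` imaginary and `a₀ ≡ −1` this
integer is the relative class number `h⁻(K₁) = h(K₁)/h(K₁⁺)`.  Plus `C^{D_v} = 0`, `(E[p]/C)^{D_v} = 0` above `p` and a ramified prime for `κ`.
[cite: Lang1990, Ch. 3 §4, Thm. 4.3 and Thm. 4.4] [cite: CoatesSujatha2005, §3 Thm. 3.4, Lemma 3.8 and Cor. 3.6]
[cite: DeoRaySujatha2023, §3 Thm. 3.8 (c2), (c3) and §5 Lemma 5.1] -/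
theorem fineSelmerDual_moduleFinite_of_reducible_of_relNorm₁_of_eigenTest₂ (hp : p ≠ 2)
    (κ : ZpExtension K p) (hκ : κ.IsCyclotomic)
    (hram : ∃ 𝔓' : Ideal (absIntegers (𝓞 K) K), 𝔓'.IsMaximal ∧
      𝔓'.inertia (absoluteGaloisGroup K) ⊔ κ.kerSubgroup = ⊤)
    (C : AddSubgroup (W.geomTorsion (p : ℤ)))
    (hC : ∀ (σ : absoluteGaloisGroup K) (x : W.geomTorsion (p : ℤ)), x ∈ C → σ • x ∈ C)
    (h1 : C ≠ ⊥) (h2 : C ≠ ⊤)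
    (P : W.geomTorsion (p : ℤ)) (hPC : P ∈ C) (hP0 : P ≠ 0)
    (P₂ : W.geomTorsion (p : ℤ)) (hP₂ : P₂ ∉ C)
    (τ₀ : absoluteGaloisGroup K) (a₀ : ℕ) (hτP : τ₀ • P = a₀ • P) (ha : ¬ a₀ ≡ 1 [MOD p])
    (hrel₁ : haveI : NeZero p := ⟨(Fact.out : p.Prime).ne_zero⟩
      haveI := isGalois_borelField (W := W) hC
      haveI := isAbelianGalois_borelField (W := W) hC
        (W.card_eq_of_ne_bot_of_ne_top (W.natCard_geomTorsion_eq_sq_of_charZero (Fact.out : p.Prime)) h1 h2)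
        (W.natCard_geomTorsion_eq_sq_of_charZero (Fact.out : p.Prime))
      haveI := numberField_intermediateField_borelField W C
        (fixedField ((fixingSubgroup (absoluteGaloisGroup K) (C : Set (W.geomTorsion (p : ℤ)))).map
          (absRestrictNormalHom (W.borelField C))))
      ¬ p ∣ Nat.card (classGroupNorm
        ↥(fixedField (Subgroup.zpowers ((absRestrictNormalHom (W.borelField C) τ₀).restrictNormal
          ↥(fixedField ((fixingSubgroup (absoluteGaloisGroup K) (C : Set (W.geomTorsion (p : ℤ)))).map
          (absRestrictNormalHom (W.borelField C))) : IntermediateField K (W.borelField C)))))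
        ↥(fixedField ((fixingSubgroup (absoluteGaloisGroup K) (C : Set (W.geomTorsion (p : ℤ)))).map
          (absRestrictNormalHom (W.borelField C))) : IntermediateField K (W.borelField C))).ker)
    (hD₁ : ∀ v : HeightOneSpectrum (𝓞 K), ((p : ℕ) : 𝓞 K) ∈ v.asIdeal →
      ∀ w : W.geomTorsion (p : ℤ), w ∈ C → (∀ d ∈ GreenbergSelmer.decomp v, d • w = w) → w = 0)
    (hEig₂ : haveI : NeZero p := ⟨(Fact.out : p.Prime).ne_zero⟩
      haveI := isGalois_borelField (W := W) hC
      haveI := numberField_intermediateField_borelField W C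
        (fixedField ((fixingSubgroup (absoluteGaloisGroup K)
          (Set.range fun y : W.geomTorsion (p : ℤ) => y +ᵥ (C : Set (W.geomTorsion (p : ℤ))))).map
          (absRestrictNormalHom (W.borelField C))))
      ∀ μ : Additive (ClassGroup (𝓞 ↥(fixedField ((fixingSubgroup (absoluteGaloisGroup K)
          (Set.range fun y : W.geomTorsion (p : ℤ) => y +ᵥ (C : Set (W.geomTorsion (p : ℤ))))).map
          (absRestrictNormalHom (W.borelField C))) : IntermediateField K (W.borelField C)))) →+ ZMod p,
        (∀ (τ : absoluteGaloisGroup K)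
            (σ : ↥(fixedField ((fixingSubgroup (absoluteGaloisGroup K)
                (Set.range fun y : W.geomTorsion (p : ℤ) => y +ᵥ (C : Set (W.geomTorsion (p : ℤ))))).map
                (absRestrictNormalHom (W.borelField C))) : IntermediateField K (W.borelField C)) ≃ₐ[K]
              ↥(fixedField ((fixingSubgroup (absoluteGaloisGroup K)
                (Set.range fun y : W.geomTorsion (p : ℤ) => y +ᵥ (C : Set (W.geomTorsion (p : ℤ))))).map
                (absRestrictNormalHom (W.borelField C))) : IntermediateField K (W.borelField C)))
            (a : ℕ),
          (∀ x : ↥(fixedField ((fixingSubgroup (absoluteGaloisGroup K)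
                (Set.range fun y : W.geomTorsion (p : ℤ) => y +ᵥ (C : Set (W.geomTorsion (p : ℤ))))).map
                (absRestrictNormalHom (W.borelField C))) : IntermediateField K (W.borelField C)),
            absRestrictNormalHom (W.borelField C) τ (x : W.borelField C) = ((σ x : ↥(fixedField ((fixingSubgroup (absoluteGaloisGroup K)
                (Set.range fun y : W.geomTorsion (p : ℤ) => y +ᵥ (C : Set (W.geomTorsion (p : ℤ))))).map
                (absRestrictNormalHom (W.borelField C))) : IntermediateField K (W.borelField C))) : W.borelField C)) →
          τ • P₂ - a • P₂ ∈ C →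
          ∀ (I J : (Ideal (𝓞 ↥(fixedField ((fixingSubgroup (absoluteGaloisGroup K)
              (Set.range fun y : W.geomTorsion (p : ℤ) => y +ᵥ (C : Set (W.geomTorsion (p : ℤ))))).map
              (absRestrictNormalHom (W.borelField C))) : IntermediateField K (W.borelField C))))⁰),
            (J : Ideal (𝓞 ↥(fixedField ((fixingSubgroup (absoluteGaloisGroup K)
                (Set.range fun y : W.geomTorsion (p : ℤ) => y +ᵥ (C : Set (W.geomTorsion (p : ℤ))))).map
                (absRestrictNormalHom (W.borelField C))) : IntermediateField K (W.borelField C)))) =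
              (I : Ideal (𝓞 ↥(fixedField ((fixingSubgroup (absoluteGaloisGroup K)
                (Set.range fun y : W.geomTorsion (p : ℤ) => y +ᵥ (C : Set (W.geomTorsion (p : ℤ))))).map
                (absRestrictNormalHom (W.borelField C))) : IntermediateField K (W.borelField C)))).map (AmbiguousClass.intAut σ : 𝓞 ↥(fixedField ((fixingSubgroup (absoluteGaloisGroup K)
                (Set.range fun y : W.geomTorsion (p : ℤ) => y +ᵥ (C : Set (W.geomTorsion (p : ℤ))))).map
                (absRestrictNormalHom (W.borelField C))) : IntermediateField K (W.borelField C)) →+* 𝓞 ↥(fixedField ((fixingSubgroup (absoluteGaloisGroup K)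
                (Set.range fun y : W.geomTorsion (p : ℤ) => y +ᵥ (C : Set (W.geomTorsion (p : ℤ))))).map
                (absRestrictNormalHom (W.borelField C))) : IntermediateField K (W.borelField C))) →
            μ (Additive.ofMul (ClassGroup.mk0 J)) = a • μ (Additive.ofMul (ClassGroup.mk0 I))) →
        μ = 0)
    (hD₂ : ∀ v : HeightOneSpectrum (𝓞 K), ((p : ℕ) : 𝓞 K) ∈ v.asIdeal →
      ∀ m : W.geomTorsion (p : ℤ), (∀ d ∈ GreenbergSelmer.decomp v, d • m - m ∈ C) → m ∈ C) :
    ∃ (γ : absoluteGaloisGroup K) (D : W.FineSelmerDualData κ γ),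
      Module.Finite ℤ_[p] (RestrictScalars ℤ_[p] (IwasawaAlgebra p) D.X) := by
  haveI : NeZero p := ⟨(Fact.out : p.Prime).ne_zero⟩
  haveI := isGalois_borelField (W := W) hC
  have hV : Nat.card (W.geomTorsion (p : ℤ)) = p ^ 2 := W.natCard_geomTorsion_eq_sq_of_charZero (Fact.out : p.Prime)
  have hcard : Nat.card C = p := W.card_eq_of_ne_bot_of_ne_top hV h1 h2
  have hab : IsAbelianGalois K ↥(W.borelField C) := isAbelianGalois_borelField (W := W) hC hcard hV
  haveI : IsAbelianGalois K ↥(fixedField ((fixingSubgroup (absoluteGaloisGroup K) (C : Set (W.geomTorsion (p : ℤ)))).map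
          (absRestrictNormalHom (W.borelField C))) : IntermediateField K (W.borelField C)) :=
    @IsAbelianGalois.tower_bot K _ ↥(W.borelField C) _ _ _ _ _ _ _ hab
  refine fineSelmerDual_moduleFinite_of_reducible_of_layerZero_or_classGroupPRank_le W hp κ hκ hram C hC h1 h2
    (Or.inl ⟨⟨_, numberField_intermediateField_borelField W C _, P, hPC, hP0,
      fun τ hτ => smul_eq_of_forall_fixedField_line W C hC τ hτ P hPC, ?_⟩, hD₁⟩)
    (Or.inl ⟨⟨_, numberField_intermediateField_borelField W C _, P₂, hP₂,
      fun τ hτ => smul_sub_mem_of_forall_fixedField_cosets W C hC τ hτ P₂, hEig₂⟩, hD₂⟩)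
  haveI := numberField_intermediateField_borelField W C
    (fixedField ((fixingSubgroup (absoluteGaloisGroup K) (C : Set (W.geomTorsion (p : ℤ)))).map
          (absRestrictNormalHom (W.borelField C))))
  exact eigenTest_of_witness_of_not_dvd_card_ker
    (fun (τ : absoluteGaloisGroup K) (σ : ↥(fixedField ((fixingSubgroup (absoluteGaloisGroup K) (C : Set (W.geomTorsion (p : ℤ)))).map
          (absRestrictNormalHom (W.borelField C))) : IntermediateField K (W.borelField C)) ≃ₐ[K]
        ↥(fixedField ((fixingSubgroup (absoluteGaloisGroup K) (C : Set (W.geomTorsion (p : ℤ)))).map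
          (absRestrictNormalHom (W.borelField C))) : IntermediateField K (W.borelField C))) =>
      ∀ x : ↥(fixedField ((fixingSubgroup (absoluteGaloisGroup K) (C : Set (W.geomTorsion (p : ℤ)))).map
          (absRestrictNormalHom (W.borelField C))) : IntermediateField K (W.borelField C)),
        absRestrictNormalHom (W.borelField C) τ (x : W.borelField C) =
          ((σ x : ↥(fixedField ((fixingSubgroup (absoluteGaloisGroup K) (C : Set (W.geomTorsion (p : ℤ)))).map
          (absRestrictNormalHom (W.borelField C))) : IntermediateField K (W.borelField C))) : W.borelField C))
    (fun (τ : absoluteGaloisGroup K) (a : ℕ) => τ • P = a • P) τ₀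
    ((absRestrictNormalHom (W.borelField C) τ₀).restrictNormal ↥(fixedField ((fixingSubgroup (absoluteGaloisGroup K) (C : Set (W.geomTorsion (p : ℤ)))).map
          (absRestrictNormalHom (W.borelField C))) : IntermediateField K (W.borelField C))) a₀
    (fun x => (AlgEquiv.restrictNormal_apply _ (absRestrictNormalHom (W.borelField C) τ₀) x).symm) hτP ha hrel₁

/-- **(A) on a reducible row: side 1 by the eigen-test at the canonical `K₁ = K(P)`, side 2 by the RELATIVE-NORM integer at the canonical
`K₂ = K(P′)`** (`τ₀•P₂ ≡ a₀•P₂ (mod C)`, `a₀ ≢ 1 (mod p)`, `p ∤ #ker (N : Cl_{K₂} → Cl_{K₂^{τ₀}})`; for `K₂` imaginary and `a₀ ≡ −1` the integer is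
`h⁻(K₂)`).  [cite: Lang1990, Ch. 3 §4, Thm. 4.3 and Thm. 4.4] [cite: CoatesSujatha2005, §3 Thm. 3.4, Lemma 3.8 and Cor. 3.6]
[cite: DeoRaySujatha2023, §3 Thm. 3.8 (c2), (c3) and §5 Lemma 5.1] -/
theorem fineSelmerDual_moduleFinite_of_reducible_of_eigenTest₁_of_relNorm₂ (hp : p ≠ 2)
    (κ : ZpExtension K p) (hκ : κ.IsCyclotomic)
    (hram : ∃ 𝔓' : Ideal (absIntegers (𝓞 K) K), 𝔓'.IsMaximal ∧
      𝔓'.inertia (absoluteGaloisGroup K) ⊔ κ.kerSubgroup = ⊤)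
    (C : AddSubgroup (W.geomTorsion (p : ℤ)))
    (hC : ∀ (σ : absoluteGaloisGroup K) (x : W.geomTorsion (p : ℤ)), x ∈ C → σ • x ∈ C)
    (h1 : C ≠ ⊥) (h2 : C ≠ ⊤)
    (P : W.geomTorsion (p : ℤ)) (hPC : P ∈ C) (hP0 : P ≠ 0)
    (P₂ : W.geomTorsion (p : ℤ)) (hP₂ : P₂ ∉ C)
    (τ₀ : absoluteGaloisGroup K) (a₀ : ℕ) (hτP : τ₀ • P₂ - a₀ • P₂ ∈ C) (ha : ¬ a₀ ≡ 1 [MOD p])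
    (hEig₁ : haveI : NeZero p := ⟨(Fact.out : p.Prime).ne_zero⟩
      haveI := isGalois_borelField (W := W) hC
      haveI := numberField_intermediateField_borelField W C
        (fixedField ((fixingSubgroup (absoluteGaloisGroup K) (C : Set (W.geomTorsion (p : ℤ)))).map
          (absRestrictNormalHom (W.borelField C))))
      ∀ μ : Additive (ClassGroup (𝓞 ↥(fixedField ((fixingSubgroup (absoluteGaloisGroup K) (C : Set (W.geomTorsion (p : ℤ)))).map
          (absRestrictNormalHom (W.borelField C))) : IntermediateField K (W.borelField C)))) →+ ZMod p,
        (∀ (τ : absoluteGaloisGroup K)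
            (σ : ↥(fixedField ((fixingSubgroup (absoluteGaloisGroup K) (C : Set (W.geomTorsion (p : ℤ)))).map
                (absRestrictNormalHom (W.borelField C))) : IntermediateField K (W.borelField C)) ≃ₐ[K]
              ↥(fixedField ((fixingSubgroup (absoluteGaloisGroup K) (C : Set (W.geomTorsion (p : ℤ)))).map
                (absRestrictNormalHom (W.borelField C))) : IntermediateField K (W.borelField C)))
            (a : ℕ),
          (∀ x : ↥(fixedField ((fixingSubgroup (absoluteGaloisGroup K) (C : Set (W.geomTorsion (p : ℤ)))).map
                (absRestrictNormalHom (W.borelField C))) : IntermediateField K (W.borelField C)),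
            absRestrictNormalHom (W.borelField C) τ (x : W.borelField C) = ((σ x : ↥(fixedField ((fixingSubgroup (absoluteGaloisGroup K) (C : Set (W.geomTorsion (p : ℤ)))).map
                (absRestrictNormalHom (W.borelField C))) : IntermediateField K (W.borelField C))) : W.borelField C)) →
          τ • P = a • P →
          ∀ (I J : (Ideal (𝓞 ↥(fixedField ((fixingSubgroup (absoluteGaloisGroup K) (C : Set (W.geomTorsion (p : ℤ)))).map
              (absRestrictNormalHom (W.borelField C))) : IntermediateField K (W.borelField C))))⁰),
            (J : Ideal (𝓞 ↥(fixedField ((fixingSubgroup (absoluteGaloisGroup K) (C : Set (W.geomTorsion (p : ℤ)))).map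
                (absRestrictNormalHom (W.borelField C))) : IntermediateField K (W.borelField C)))) =
              (I : Ideal (𝓞 ↥(fixedField ((fixingSubgroup (absoluteGaloisGroup K) (C : Set (W.geomTorsion (p : ℤ)))).map
                (absRestrictNormalHom (W.borelField C))) : IntermediateField K (W.borelField C)))).map (AmbiguousClass.intAut σ : 𝓞 ↥(fixedField ((fixingSubgroup (absoluteGaloisGroup K) (C : Set (W.geomTorsion (p : ℤ)))).map
                (absRestrictNormalHom (W.borelField C))) : IntermediateField K (W.borelField C)) →+* 𝓞 ↥(fixedField ((fixingSubgroup (absoluteGaloisGroup K) (C : Set (W.geomTorsion (p : ℤ)))).map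
                (absRestrictNormalHom (W.borelField C))) : IntermediateField K (W.borelField C))) →
            μ (Additive.ofMul (ClassGroup.mk0 J)) = a • μ (Additive.ofMul (ClassGroup.mk0 I))) →
        μ = 0)
    (hD₁ : ∀ v : HeightOneSpectrum (𝓞 K), ((p : ℕ) : 𝓞 K) ∈ v.asIdeal →
      ∀ w : W.geomTorsion (p : ℤ), w ∈ C → (∀ d ∈ GreenbergSelmer.decomp v, d • w = w) → w = 0)
    (hrel₂ : haveI : NeZero p := ⟨(Fact.out : p.Prime).ne_zero⟩
      haveI := isGalois_borelField (W := W) hC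
      haveI := isAbelianGalois_borelField (W := W) hC
        (W.card_eq_of_ne_bot_of_ne_top (W.natCard_geomTorsion_eq_sq_of_charZero (Fact.out : p.Prime)) h1 h2)
        (W.natCard_geomTorsion_eq_sq_of_charZero (Fact.out : p.Prime))
      haveI := numberField_intermediateField_borelField W C
        (fixedField ((fixingSubgroup (absoluteGaloisGroup K)
          (Set.range fun y : W.geomTorsion (p : ℤ) => y +ᵥ (C : Set (W.geomTorsion (p : ℤ))))).map
          (absRestrictNormalHom (W.borelField C))))
      ¬ p ∣ Nat.card (classGroupNorm
        ↥(fixedField (Subgroup.zpowers ((absRestrictNormalHom (W.borelField C) τ₀).restrictNormal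
          ↥(fixedField ((fixingSubgroup (absoluteGaloisGroup K)
          (Set.range fun y : W.geomTorsion (p : ℤ) => y +ᵥ (C : Set (W.geomTorsion (p : ℤ))))).map
          (absRestrictNormalHom (W.borelField C))) : IntermediateField K (W.borelField C)))))
        ↥(fixedField ((fixingSubgroup (absoluteGaloisGroup K)
          (Set.range fun y : W.geomTorsion (p : ℤ) => y +ᵥ (C : Set (W.geomTorsion (p : ℤ))))).map
          (absRestrictNormalHom (W.borelField C))) : IntermediateField K (W.borelField C))).ker)
    (hD₂ : ∀ v : HeightOneSpectrum (𝓞 K), ((p : ℕ) : 𝓞 K) ∈ v.asIdeal →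
      ∀ m : W.geomTorsion (p : ℤ), (∀ d ∈ GreenbergSelmer.decomp v, d • m - m ∈ C) → m ∈ C) :
    ∃ (γ : absoluteGaloisGroup K) (D : W.FineSelmerDualData κ γ),
      Module.Finite ℤ_[p] (RestrictScalars ℤ_[p] (IwasawaAlgebra p) D.X) := by
  haveI : NeZero p := ⟨(Fact.out : p.Prime).ne_zero⟩
  haveI := isGalois_borelField (W := W) hC
  have hV : Nat.card (W.geomTorsion (p : ℤ)) = p ^ 2 := W.natCard_geomTorsion_eq_sq_of_charZero (Fact.out : p.Prime)
  have hcard : Nat.card C = p := W.card_eq_of_ne_bot_of_ne_top hV h1 h2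
  have hab : IsAbelianGalois K ↥(W.borelField C) := isAbelianGalois_borelField (W := W) hC hcard hV
  haveI : IsAbelianGalois K ↥(fixedField ((fixingSubgroup (absoluteGaloisGroup K)
          (Set.range fun y : W.geomTorsion (p : ℤ) => y +ᵥ (C : Set (W.geomTorsion (p : ℤ))))).map
          (absRestrictNormalHom (W.borelField C))) : IntermediateField K (W.borelField C)) :=
    @IsAbelianGalois.tower_bot K _ ↥(W.borelField C) _ _ _ _ _ _ _ hab
  refine fineSelmerDual_moduleFinite_of_reducible_of_layerZero_or_classGroupPRank_le W hp κ hκ hram C hC h1 h2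
    (Or.inl ⟨⟨_, numberField_intermediateField_borelField W C _, P, hPC, hP0,
      fun τ hτ => smul_eq_of_forall_fixedField_line W C hC τ hτ P hPC, hEig₁⟩, hD₁⟩)
    (Or.inl ⟨⟨_, numberField_intermediateField_borelField W C _, P₂, hP₂,
      fun τ hτ => smul_sub_mem_of_forall_fixedField_cosets W C hC τ hτ P₂, ?_⟩, hD₂⟩)
  haveI := numberField_intermediateField_borelField W C
    (fixedField ((fixingSubgroup (absoluteGaloisGroup K)
          (Set.range fun y : W.geomTorsion (p : ℤ) => y +ᵥ (C : Set (W.geomTorsion (p : ℤ))))).map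
          (absRestrictNormalHom (W.borelField C))))
  exact eigenTest_of_witness_of_not_dvd_card_ker
    (fun (τ : absoluteGaloisGroup K) (σ : ↥(fixedField ((fixingSubgroup (absoluteGaloisGroup K)
          (Set.range fun y : W.geomTorsion (p : ℤ) => y +ᵥ (C : Set (W.geomTorsion (p : ℤ))))).map
          (absRestrictNormalHom (W.borelField C))) : IntermediateField K (W.borelField C)) ≃ₐ[K]
        ↥(fixedField ((fixingSubgroup (absoluteGaloisGroup K)
          (Set.range fun y : W.geomTorsion (p : ℤ) => y +ᵥ (C : Set (W.geomTorsion (p : ℤ))))).map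
          (absRestrictNormalHom (W.borelField C))) : IntermediateField K (W.borelField C))) =>
      ∀ x : ↥(fixedField ((fixingSubgroup (absoluteGaloisGroup K)
          (Set.range fun y : W.geomTorsion (p : ℤ) => y +ᵥ (C : Set (W.geomTorsion (p : ℤ))))).map
          (absRestrictNormalHom (W.borelField C))) : IntermediateField K (W.borelField C)),
        absRestrictNormalHom (W.borelField C) τ (x : W.borelField C) =
          ((σ x : ↥(fixedField ((fixingSubgroup (absoluteGaloisGroup K)
          (Set.range fun y : W.geomTorsion (p : ℤ) => y +ᵥ (C : Set (W.geomTorsion (p : ℤ))))).map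
          (absRestrictNormalHom (W.borelField C))) : IntermediateField K (W.borelField C))) : W.borelField C))
    (fun (τ : absoluteGaloisGroup K) (a : ℕ) => τ • P₂ - a • P₂ ∈ C) τ₀
    ((absRestrictNormalHom (W.borelField C) τ₀).restrictNormal ↥(fixedField ((fixingSubgroup (absoluteGaloisGroup K)
          (Set.range fun y : W.geomTorsion (p : ℤ) => y +ᵥ (C : Set (W.geomTorsion (p : ℤ))))).map
          (absRestrictNormalHom (W.borelField C))) : IntermediateField K (W.borelField C))) a₀
    (fun x => (AlgEquiv.restrictNormal_apply _ (absRestrictNormalHom (W.borelField C) τ₀) x).symm) hτP ha hrel₂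

end Canonical


end Summit.BirchSwinnertonDyer.BirchSwinnertonDyer.Theorems.ReducibleFineSelmerRelativeClassNumberCanonical

end
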